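import Literature.NumberTheory.GaloisRepresentations.GalLayerSystemUnitsBar
import Literature.NumberTheory.GaloisRepresentations.IdeleClassBarSubgroupHOne
import Literature.Algebra.Homology.DiscreteRepSubgroupLayers
import Literature.Algebra.Homology.BrauerGroupInflationRestriction
import Literature.NumberTheory.GaloisRepresentations.AbsGaloisGroupCompact

/-!
# `lim→_E Eˣ = F̄ˣ` for ANY field with `F̄/F` Galois, and Hilbert 90 at every OPEN subgroup:
# `Ext¹_{C_V}(ℤ, Res_V F̄ˣ) = 0` for `V ≤ Γ_F` open (Serre, *Local Fields* X §1 Prop. 2 at the field `F̄^V`)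

Topic `NumberTheory/GaloisRepresentations`; namespace `Literature.NumberTheory.GaloisRepresentations`.  Definitions with
bodies and theorems; no named fact, no instance, no `sorry`.  GENERALISATION of door-c5's `unitsData` /
`GalLayerSystemUnitsBar` (`unitsBarToUnits`, `unitsBarAddEquiv`, `unitsBarIso`), which carry `[NumberField F]` although
their bodies use the number field only through `IsGalois F (AlgebraicClosure F)`: the same bodies are re-typed here under
that hypothesis (plus compactness of `Γ_F`, the tree's `instCompactSpace` in characteristic `0`), so that the statements
hold for local fields `K_v`.  The number-field declarations are the `NumberField` instances of these; nothing of theirs is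
restated with the same hypotheses.

* §0 the layer dictionary for any Galois `F̄/F`: `GalLayer.ofOpenNormalSubgroupGal U` (the layer `F̄^U`), `…_val`,
  `openNormalSubgroup_ofOpenNormalSubgroupGal`, `ofOpenNormalSubgroupGal_openNormalSubgroup` (door-c5's
  `GalLayer.ofOpenNormalSubgroup` is the number-field instance); the open-subgroup vanishing transfer of door-c6
  (`GalLayerData.ext_res_eq_zero_of_forall_subgroupImage`) re-run on it is kept PRIVATE here (its statement repeats the
  number-field one under the weaker hypothesis);
* `GalLayer.adjoinGal` (a layer containing a given `a ∈ F̄`), **`unitsDataGal F : GalLayerData F`** (`E ↦ Eˣ`),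
  `unitsBarToUnitsGal` (+ `_of`, `_injective`, `_surjective`, `_rep`), `unitsBarAddEquivGal`, `unitsBarRepIsoGal`,
  **`unitsBarIsoGal : (unitsDataGal F).toSystem.toD ≅ ofDiscreteGaloisModule (units F)`**;
* **`ext_one_res_unitsBarGal_eq_zero`**, **`ext_one_res_units_eq_zero`** — `Ext¹_{C_V}(ℤ, Res_V F̄ˣ) = 0` for every
  OPEN subgroup `V ≤ Γ_F` (transfer `GalLayerData.ext_res_eq_zero_of_forall_subgroupImage_gal` + Hilbert 90 at every
  subgroup of every finite layer, `InflationRestriction.isZero_H1_res_units`).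

Written for the localisation inputs of lane «PT-Ш-S-TC» (crux `stmt-BirchSwinnertonDyer-19032`, cell bsd-eis, seat
bsd-line-x1-p1-w3 gen 18; -w4 g20's [P1-epi-local] at `F := v.adicCompletion K`).  HONEST FRAMING: Hilbert 90 bookkeeping;
nothing beyond it is proved here.

## References
* J.-P. Serre, *Local Fields*, GTM 67 (1979), X §1 Proposition 2 (Hilbert 90). [Serre1979]
* J.-P. Serre, *Galois Cohomology*, Springer (1997), I §2.2 Proposition 8, II §1.1. [SerreGaloisCohomology1997]
-/

noncomputable section

open CategoryTheory
open Field (absoluteGaloisGroup)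
open Literature.Algebra.Homology
open scoped Classical

namespace Literature.NumberTheory.GaloisRepresentations

open IdeleClassBar

/-! ## §0 The layer dictionary and the open-subgroup transfer, any field with `F̄/F` Galois -/

namespace IdeleClassBar

namespace GalLayer

variable {F : Type} [Field F] [IsGalois F (AlgebraicClosure F)]

/-- **The layer `F̄^U` of an open normal subgroup `U ≤ Γ_F`**, for any field with `F̄/F` Galois: finite (`U` open,
Mathlib `InfiniteGalois.isOpen_iff_finite`) and Galois (`U` normal) over `F`.  (`GalLayer.ofOpenNormalSubgroup` is the
number-field instance.) [cite: SerreGaloisCohomology1997, I §2.2] -/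
def ofOpenNormalSubgroupGal (U : OpenNormalSubgroup (absoluteGaloisGroup F)) : GalLayer F :=
  ⟨IntermediateField.fixedField (U : Subgroup (absoluteGaloisGroup F)),
    (InfiniteGalois.isOpen_iff_finite _).1 (by
      rw [InfiniteGalois.fixingSubgroup_fixedField
        ⟨(U : Subgroup (absoluteGaloisGroup F)), U.toOpenSubgroup.isClosed⟩]
      exact U.toOpenSubgroup.isOpen),
    IsGalois.of_fixedField_normal_subgroup (U : Subgroup (absoluteGaloisGroup F))⟩

/-- `(ofOpenNormalSubgroupGal U).1 = F̄^U`. [cite: SerreGaloisCohomology1997, I §2.2] -/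
theorem ofOpenNormalSubgroupGal_val (U : OpenNormalSubgroup (absoluteGaloisGroup F)) :
    (ofOpenNormalSubgroupGal U).1 = IntermediateField.fixedField (U : Subgroup (absoluteGaloisGroup F)) := rfl

/-- `U_{F̄^U} = U`. [cite: SerreGaloisCohomology1997, I §2.2] -/
theorem openNormalSubgroup_ofOpenNormalSubgroupGal (U : OpenNormalSubgroup (absoluteGaloisGroup F)) :
    (ofOpenNormalSubgroupGal U).openNormalSubgroup = U := by
  apply OpenNormalSubgroup.toSubgroup_injective
  exact InfiniteGalois.fixingSubgroup_fixedField
    ⟨(U : Subgroup (absoluteGaloisGroup F)), U.toOpenSubgroup.isClosed⟩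

/-- `F̄^{U_E} = E`. [cite: SerreGaloisCohomology1997, I §2.2] -/
theorem ofOpenNormalSubgroupGal_openNormalSubgroup (E : GalLayer F) :
    ofOpenNormalSubgroupGal E.openNormalSubgroup = E :=
  Subtype.ext (InfiniteGalois.fixedField_fixingSubgroup E.1)

/-- Every open normal subgroup of `Γ_F` is `U_E` for a layer `E` (private twin of the number-field
`GalLayer.exists_openNormalSubgroup_eq`, whose statement it repeats under the weaker hypothesis).
[cite: SerreGaloisCohomology1997, I §2.2] -/
private theorem exists_openNormalSubgroup_eq_gal (U : OpenNormalSubgroup (absoluteGaloisGroup F)) :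
    ∃ E : GalLayer F, E.openNormalSubgroup = U :=
  ⟨ofOpenNormalSubgroupGal U, openNormalSubgroup_ofOpenNormalSubgroupGal U⟩

end GalLayer

end IdeleClassBar

/-! ## The vanishing transfers at an open subgroup, any field with `F̄/F` Galois -/

namespace GalLayerData

open IdeleClassBar

variable {F : Type} [Field F] [IsGalois F (AlgebraicClosure F)] [CompactSpace (absoluteGaloisGroup F)]
  (D : GalLayerData F) (U : Subgroup (absoluteGaloisGroup F))

/-- **Transfer**: if every `Hⁿ(H_E, Res_{H_E} D_E)` (`U_E ≤ U`) vanishes then `Extⁿ_{C_U}(ℤ, Res_U lim D) = 0` (`U` open).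
Door-c6's proof (`ext_res_eq_zero_of_forall_subgroupImage`) verbatim on the general dictionary.
[cite: SerreGaloisCohomology1997, I §2.2 Proposition 8][cite: Harari2020, §16.1 Definition 16.1] -/
private theorem ext_res_eq_zero_of_forall_subgroupImage_gal (hU : IsOpen (U : Set (absoluteGaloisGroup F))) (n : ℕ)
    (h : ∀ (E : GalLayer F), (E.openNormalSubgroup : Subgroup (absoluteGaloisGroup F)) ≤ U →
      ∀ c : groupCohomology (Rep.res (GalLayer.subgroupImage U E).subtype (D.obj E)) n, c = 0)
    (x : Abelian.Ext (DiscreteRep.triv (Γ := U) ℤ) ((DiscreteRep.resD ℤ U).obj D.toSystem.toD) n) : x = 0 := by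
  refine DiscreteRep.LayerColimit.ext_res_eq_zero_of_forall_trace_eq_zero U hU n D.toSystem.toD
    (fun V hVU c => ?_) x
  obtain ⟨E, rfl⟩ := GalLayer.exists_openNormalSubgroup_eq_gal V
  exact D.relLayer_eq_zero_of_subgroupImage U hVU n c (h E hVU _)

end GalLayerData


variable (F : Type) [Field F] [IsGalois F (AlgebraicClosure F)]

namespace IdeleClassBar.GalLayer

/-- **A finite Galois layer containing a given element of `F̄`** (Mathlib `FiniteGaloisIntermediateField.adjoin`), for any
Galois `F̄/F` (`GalLayer.adjoin` is the number-field instance). [cite: SerreGaloisCohomology1997, II §1.1] -/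
def adjoinGal (a : AlgebraicClosure F) : GalLayer F :=
  ⟨(FiniteGaloisIntermediateField.adjoin F ({a} : Set (AlgebraicClosure F))).toIntermediateField,
    (FiniteGaloisIntermediateField.adjoin F ({a} : Set (AlgebraicClosure F))).finiteDimensional,
    (FiniteGaloisIntermediateField.adjoin F ({a} : Set (AlgebraicClosure F))).isGalois⟩

/-- `a ∈ adjoinGal F a`. [cite: SerreGaloisCohomology1997, II §1.1] -/
theorem mem_adjoinGal (a : AlgebraicClosure F) : a ∈ (adjoinGal F a).1 :=
  FiniteGaloisIntermediateField.subset_adjoin F ({a} : Set (AlgebraicClosure F)) (Set.mem_singleton a)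

end IdeleClassBar.GalLayer

/-! ## §1 The system `E ↦ Eˣ` -/

/-- **The system `E ↦ Eˣ`** (units of the layers with the Galois action, base change = inclusion, descent by Galois theory
`F̄^{Gal(F̄/E)} = E`) — door-c5's `unitsData` for any Galois `F̄/F`. [cite: SerreGaloisCohomology1997, II §1.1] -/
def unitsDataGal : GalLayerData F where
  V E := AddCommGrpCat.of (Additive (E.1)ˣ)
  ρ E := Representation.ofMulDistribMulAction (E.1 ≃ₐ[F] E.1) (E.1)ˣ
  base E E' h :=
    letI := GalLayer.algebraOfLE h
    MonoidHom.toAdditive (α := (E.1)ˣ) (β := (E'.1)ˣ) (Units.map (algebraMap E.1 E'.1 : E.1 →+* E'.1).toMonoidHom)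
  base_base E E' E'' h h' x := Additive.toMul.injective (Units.ext (Subtype.ext rfl))
  base_injective E E' h := fun x y hxy =>
    Additive.toMul.injective (Units.ext (Subtype.ext
      (congrArg (fun u : Additive (E'.1)ˣ => (((Additive.toMul u : (E'.1)ˣ) : E'.1) : AlgebraicClosure F)) hxy)))
  base_ρ E E' h σ x := by
    letI := GalLayer.algebraOfLE h
    refine Additive.toMul.injective (Units.ext (Subtype.ext ?_))
    exact (GalLayer.coe_restrictHom_apply E σ ((Additive.toMul x : (E.1)ˣ) : E.1)).trans
      (GalLayer.coe_restrictHom_apply E' σ (algebraMap E.1 E'.1 ((Additive.toMul x : (E.1)ˣ) : E.1))).symm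
  descent E M h y hy := by
    have hfix : ∀ σ : AlgebraicClosure F ≃ₐ[F] AlgebraicClosure F, σ ∈ E.1.fixingSubgroup →
        σ (((Additive.toMul y : (M.1)ˣ) : M.1) : AlgebraicClosure F) =
          (((Additive.toMul y : (M.1)ˣ) : M.1) : AlgebraicClosure F) := fun σ hσ => by
      have h1 := congrArg
        (fun a : Additive (M.1)ˣ => (((Additive.toMul a : (M.1)ˣ) : M.1) : AlgebraicClosure F)) (hy σ hσ)
      exact (GalLayer.coe_restrictHom_apply M σ _).symm.trans h1
    have hmem : (((Additive.toMul y : (M.1)ˣ) : M.1) : AlgebraicClosure F) ∈ E.1 := by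
      rw [← InfiniteGalois.fixedField_fixingSubgroup E.1, IntermediateField.mem_fixedField_iff]
      exact fun σ hσ => hfix σ hσ
    have hne : (⟨_, hmem⟩ : E.1) ≠ 0 := fun h0 => by
      have h0' : (((Additive.toMul y : (M.1)ˣ) : M.1) : AlgebraicClosure F) = 0 := congrArg Subtype.val h0
      exact (Additive.toMul y : (M.1)ˣ).ne_zero (Subtype.ext h0')
    exact ⟨Additive.ofMul (Units.mk0 _ hne), Additive.toMul.injective (Units.ext (Subtype.ext rfl))⟩

/-- `(unitsDataGal F).obj E` is Mathlib's `Rep.ofAlgebraAutOnUnits F E` (definitionally). [cite: SerreGaloisCohomology1997, II §1.1] -/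
theorem unitsDataGal_obj (E : GalLayer F) : (unitsDataGal F).obj E = Rep.ofAlgebraAutOnUnits F E.1 := rfl

/-! ## §2 `lim→ Eˣ → F̄ˣ` and the isomorphism with the Galois module `F̄ˣ` -/

/-- **The canonical map `lim→_E Eˣ → F̄ˣ`**. [cite: SerreGaloisCohomology1997, II §1.1] -/
def unitsBarToUnitsGal : (unitsDataGal F).toSystem.limit →+ Additive (AlgebraicClosure F)ˣ :=
  AddCommGroup.DirectLimit.lift _ _ _
    (fun E : GalLayer F => MonoidHom.toAdditive (α := (E.1)ˣ) (β := (AlgebraicClosure F)ˣ)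
      (Units.map (algebraMap E.1 (AlgebraicClosure F)).toMonoidHom))
    fun _ _ _ _ => Additive.toMul.injective (Units.ext rfl)

/-- `lim→ Eˣ → F̄ˣ` on a layer is the inclusion `Eˣ ⊆ F̄ˣ`. [cite: SerreGaloisCohomology1997, II §1.1] -/
theorem unitsBarToUnitsGal_of (E : GalLayer F) (x : (unitsDataGal F).V E) :
    unitsBarToUnitsGal F ((unitsDataGal F).toSystem.of E x) =
      Additive.ofMul (Units.map (algebraMap E.1 (AlgebraicClosure F)).toMonoidHom (Additive.toMul x : (E.1)ˣ)) := by
  unfold unitsBarToUnitsGal GalLayerSystem.of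
  rw [AddCommGroup.DirectLimit.lift_of]
  rfl

/-- **`lim→ Eˣ → F̄ˣ` is injective.** [cite: SerreGaloisCohomology1997, II §1.1] -/
theorem unitsBarToUnitsGal_injective : Function.Injective (unitsBarToUnitsGal F) := by
  haveI := GalLayer.nonempty F
  haveI := GalLayer.isDirectedOrder F
  haveI := (unitsDataGal F).toSystem.directedSystem
  unfold unitsBarToUnitsGal
  refine AddCommGroup.DirectLimit.lift_injective _ _ _ fun E x y hxy => ?_
  exact (Additive.toMul (α := (E.1)ˣ)).injective (Units.ext (Subtype.ext
    (congrArg (fun u : Additive (AlgebraicClosure F)ˣ =>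
      ((Additive.toMul u : (AlgebraicClosure F)ˣ) : AlgebraicClosure F)) hxy)))

/-- **`lim→ Eˣ → F̄ˣ` is surjective** (every unit of `F̄` lies in a finite Galois layer).
[cite: SerreGaloisCohomology1997, II §1.1] -/
theorem unitsBarToUnitsGal_surjective : Function.Surjective (unitsBarToUnitsGal F) := fun a => by
  set u : (AlgebraicClosure F)ˣ := Additive.toMul a with hu
  have hne : (⟨(u : AlgebraicClosure F), GalLayer.mem_adjoinGal F (u : AlgebraicClosure F)⟩ :
      (GalLayer.adjoinGal F (u : AlgebraicClosure F)).1) ≠ 0 := fun h0 =>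
    u.ne_zero (congrArg Subtype.val h0)
  refine ⟨(unitsDataGal F).toSystem.of (GalLayer.adjoinGal F (u : AlgebraicClosure F)) (Additive.ofMul (Units.mk0 _ hne)), ?_⟩
  rw [unitsBarToUnitsGal_of]
  exact congrArg Additive.ofMul (Units.ext rfl)

/-- **`lim→ Eˣ → F̄ˣ` is `Γ_F`-equivariant.** [cite: SerreGaloisCohomology1997, II §1.1] -/
theorem unitsBarToUnitsGal_rep (σ : absoluteGaloisGroup F) (z : (unitsDataGal F).toSystem.limit) :
    unitsBarToUnitsGal F ((unitsDataGal F).toSystem.rep σ z) =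
      Additive.ofMul ((σ : AlgebraicClosure F ≃ₐ[F] AlgebraicClosure F) •
        (Additive.toMul (unitsBarToUnitsGal F z) : (AlgebraicClosure F)ˣ)) := by
  obtain ⟨E, x, rfl⟩ := (unitsDataGal F).toSystem.exists_of z
  rw [GalLayerSystem.rep_of, unitsBarToUnitsGal_of, unitsBarToUnitsGal_of]
  refine congrArg Additive.ofMul (Units.ext ?_)
  exact GalLayer.coe_restrictHom_apply E σ _

/-- **`lim→_E Eˣ ≃+ F̄ˣ`** (the tree's carrier `UnitsCarrier F = Additive F̄ˣ`). [cite: SerreGaloisCohomology1997, II §1.1] -/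
def unitsBarAddEquivGal : (unitsDataGal F).toSystem.limit ≃+ DiscreteGaloisModule.UnitsCarrier F :=
  (AddEquiv.ofBijective (unitsBarToUnitsGal F)
    ⟨unitsBarToUnitsGal_injective F, unitsBarToUnitsGal_surjective F⟩).trans
    DiscreteGaloisModule.UnitsCarrier.toAdditive.symm

/-- Formula for `unitsBarAddEquivGal` through `UnitsCarrier.toAdditive`. [cite: SerreGaloisCohomology1997, II §1.1] -/
theorem toAdditive_unitsBarAddEquivGal (z : (unitsDataGal F).toSystem.limit) :
    DiscreteGaloisModule.UnitsCarrier.toAdditive (unitsBarAddEquivGal F z) = unitsBarToUnitsGal F z := rfl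

/-- **Equivariance of `lim→ Eˣ ≃+ F̄ˣ`.** [cite: SerreGaloisCohomology1997, II §1.1] -/
theorem unitsBarAddEquivGal_rep (σ : absoluteGaloisGroup F) (z : (unitsDataGal F).toSystem.limit) :
    unitsBarAddEquivGal F ((unitsDataGal F).toSystem.rep σ z) =
      DiscreteGaloisModule.units F σ (unitsBarAddEquivGal F z) := by
  apply DiscreteGaloisModule.UnitsCarrier.toAdditive.injective
  rw [DiscreteGaloisModule.units_apply_apply, toAdditive_unitsBarAddEquivGal, toAdditive_unitsBarAddEquivGal,
    unitsBarToUnitsGal_rep]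

/-- **`lim→ Eˣ ≅ F̄ˣ` as integral representations of `Γ_F`.** [cite: SerreGaloisCohomology1997, II §1.1] -/
def unitsBarRepIsoGal :
    (unitsDataGal F).toSystem.toRep ≅ Rep.of (DiscreteGaloisModule.units F).toRepresentation :=
  Rep.mkIso (Representation.Equiv.mk (unitsBarAddEquivGal F).toIntLinearEquiv fun σ =>
    LinearMap.ext fun z => unitsBarAddEquivGal_rep F σ z)

/-- **`lim→_E Eˣ ≅ F̄ˣ` in `C_{Γ_F}`** (door-c4's `ofDiscreteGaloisModule (units F)`).
[cite: SerreGaloisCohomology1997, II §1.1] -/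
def unitsBarIsoGal :
    (unitsDataGal F).toSystem.toD ≅ DiscreteRep.ofDiscreteGaloisModule (DiscreteGaloisModule.units F) :=
  (DiscreteRep.isDiscrete ℤ (absoluteGaloisGroup F)).fullyFaithfulι.preimageIso (unitsBarRepIsoGal F)

/-! ## §3 Hilbert 90 at every open subgroup -/

variable [CompactSpace (absoluteGaloisGroup F)] {F}

/-- **`Ext¹_{C_V}(ℤ, Res_V lim→ Eˣ) = 0` for every open subgroup `V ≤ Γ_F`**: the transfer at an open subgroup and
Hilbert 90 for every subgroup of every finite Galois layer (`InflationRestriction.isZero_H1_res_units`).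
[cite: Serre1979, X §1 Proposition 2][cite: SerreGaloisCohomology1997, I §2.2 Proposition 8] -/
theorem ext_one_res_unitsBarGal_eq_zero (V : Subgroup (absoluteGaloisGroup F))
    (hV : IsOpen (V : Set (absoluteGaloisGroup F)))
    (x : Abelian.Ext (DiscreteRep.triv (Γ := V) ℤ) ((DiscreteRep.resD ℤ V).obj (unitsDataGal F).toSystem.toD) 1) :
    x = 0 := by
  refine (unitsDataGal F).ext_res_eq_zero_of_forall_subgroupImage_gal V hV 1 (fun E _ c => ?_) x
  haveI := E.finiteDimensional
  haveI := E.isGalois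
  exact @Subsingleton.elim _ (ModuleCat.subsingleton_of_isZero
    (InflationRestriction.isZero_H1_res_units F E.1 (GalLayer.subgroupImage V E))) c 0

/-- **Hilbert 90 at an open subgroup: `Ext¹_{C_V}(ℤ, Res_V F̄ˣ) = 0`** for every open `V ≤ Γ_F`, with `F̄ˣ` door-c4's
`ofDiscreteGaloisModule (units F)` (transport along `unitsBarIsoGal`).
[cite: Serre1979, X §1 Proposition 2][cite: SerreGaloisCohomology1997, I §2.2 Proposition 8] -/
theorem ext_one_res_units_eq_zero (V : Subgroup (absoluteGaloisGroup F)) (hV : IsOpen (V : Set (absoluteGaloisGroup F)))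
    (x : Abelian.Ext (DiscreteRep.triv (Γ := V) ℤ)
      ((DiscreteRep.resD ℤ V).obj (DiscreteRep.ofDiscreteGaloisModule (DiscreteGaloisModule.units F))) 1) : x = 0 := by
  set i := (DiscreteRep.resD ℤ V).mapIso (unitsBarIsoGal F) with hi
  have hx : x = (x.comp (Abelian.Ext.mk₀ i.inv) (add_zero 1)).comp (Abelian.Ext.mk₀ i.hom) (add_zero 1) := by
    rw [Abelian.Ext.comp_assoc_of_second_deg_zero, Abelian.Ext.mk₀_comp_mk₀, Iso.inv_hom_id,
      Abelian.Ext.comp_mk₀_id]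
  rw [hx, ext_one_res_unitsBarGal_eq_zero V hV (x.comp (Abelian.Ext.mk₀ i.inv) (add_zero 1)),
    Abelian.Ext.zero_comp]

/-! ## §4 The local fields `K_v` of a number field -/

/-- **Hilbert 90 at every open subgroup of `Γ_{K_v}`**: for a number field `K`, a finite place `v` and an open subgroup
`V ≤ Γ_{K_v}`, `Ext¹_{C_V}(ℤ, Res_V K̄_vˣ) = 0` (`K̄_vˣ` = `ofDiscreteGaloisModule (units (v.adicCompletion K))`, -w4 g20's
`unitsD`) — input [P1-epi-local] of the permutation dévissage for hypothesis (Λ2) of Milne's `Ext` road.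
[cite: Serre1979, X §1 Proposition 2] -/
theorem ext_one_res_units_adicCompletion_eq_zero (K : Type) [Field K] [NumberField K]
    (v : IsDedekindDomain.HeightOneSpectrum (NumberField.RingOfIntegers K))
    (V : Subgroup (absoluteGaloisGroup (v.adicCompletion K)))
    (hV : IsOpen (V : Set (absoluteGaloisGroup (v.adicCompletion K))))
    (z : Abelian.Ext (DiscreteRep.triv (Γ := V) ℤ)
      ((DiscreteRep.resD ℤ V).obj (DiscreteRep.ofDiscreteGaloisModule
        (DiscreteGaloisModule.units (v.adicCompletion K)))) 1) : z = 0 :=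
  haveI : CharZero (v.adicCompletion K) :=
    charZero_of_injective_algebraMap (algebraMap K (v.adicCompletion K)).injective
  haveI : IsGalois (v.adicCompletion K) (AlgebraicClosure (v.adicCompletion K)) := {}
  haveI : CompactSpace (absoluteGaloisGroup (v.adicCompletion K)) := absoluteGaloisGroup_compactSpace _
  ext_one_res_units_eq_zero V hV z

end Literature.NumberTheory.GaloisRepresentations

end
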